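/-
Copyright (c) 2026 the pub-hodgecm-mathlib formalisation cell (harness21).  Prover seat hodgecm-mathlib-F0P3a-p01 (g37), FLOOR 0, SUPPORTS-ONLY on h413; β-BOARD v1 R10
(assembler): the `hRest` glue, part 4 — THE REST ASSEMBLY MODULO THE PENDING ROWS (★ socket ∘ ★ dispatchers at the derived record, every ★ row plugged by name).  2026-09-04.
-/
import Summits.HodgeConjecture.HodgeConjecture.Theorems.F0P3cDyRamLabelledOddRestDispatchG1     -- ★ p861555 (this seat): tower-1 dispatcher
import Summits.HodgeConjecture.HodgeConjecture.Theorems.F0P3cDyRamLabelledOddRestDispatchG2     -- ★ p861654 (this seat): tower-2 dispatcher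
import Summits.HodgeConjecture.HodgeConjecture.Theorems.F0P3cDyRamLabelledOddRestDispatchG3     -- ★ p861726 (this seat): tower-3 dispatcher
import Summits.HodgeConjecture.HodgeConjecture.Theorems.F0P3cDyRamLabelledOddGlueClassesG2      -- (this seat; ★-pending): R7-A₂∕B₂; brings ★ p861363 (LH7-p05 (g0)) R7-A∕B tower 1
import Summits.HodgeConjecture.HodgeConjecture.Theorems.F0P3cDyRamLabelledOddOffLocusShellG3    -- ★ p861708 (LH4-p11 (g9)): tower-3 off-locus zero (B-Z1)
import Summits.HodgeConjecture.HodgeConjecture.Theorems.F0P3cDyRamOddLabelledRestReindex        -- ★ p861328∕p861451 (this seat): the socket `sum_box_restShape_eq_of_rows`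
import Summits.HodgeConjecture.HodgeConjecture.Theorems.F0P3cDyRamLabelledOddStageBTable        -- ★ p861403 (this seat): (T2) trunk; brings the derived-record lemmas, `two_le_d_of_v_two_lt_one`
import HarnessLib

/-!
# Crux `H413`, LH4 «(D-RAM) FOUR-FRAME» road, STAGE 1b (β) — THE `hRest` GLUE, PART 4: THE REST ASSEMBLY MODULO THE PENDING ROWS

Cell `hodgecm-mathlib` (D-0151), FLOOR 0, crux item H413 = `stmt-HodgeConjecture-24833`, route `HCCMUnconditional`; squad F0∕P3c∕LH4.  THEOREMS ONLY (no `def`, no instance, no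
notation, no `sorry`, default heartbeats); lane `--supports stmt-HodgeConjecture-24833 --as helper` (count-neutral; pays NO row).

WHAT THIS FILE DOES.  The (T2) trunk ★ p861403 `hbox_of_oddBoxSum` takes ONE rest hypothesis `hRest`: at every derived-record datum and every slot `i`,
`Σ_{a ∈ box} [IsRestShape d n₁ n₂ n₃ a] · v_i(a) = restTarget q d n₁ n₂ n₃ ω_A ω_B ω_C ω(−1) i`.  Here that sum is computed ONCE AND FOR ALL from the row heads: the ★ socket
`sum_box_restShape_eq_of_rows` (rest shapes = hanging line `H(ρ)` + the three towers' non-tube glued classes) composed with the three ★ per-tower dispatchers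
`restValue_G{1,2,3}_of_rows` at the DERIVED record `N₀ = n0DerivedOfRecord d` (`2 ≤ d ≤ N₀`, `mcOfRecord d ≤ N₀` discharged from `|2| < 1` and the ★ record lemmas), with every
row that is ★ in the tree plugged BY NAME — tower 1: R7-A ★ p861363 `…_of_offFoot`, R7-B ★ p861363 `…_of_foot_tube` ⊔ `…_of_foot_top`, A′ (inside the dispatcher); tower 2:
R7-A₂∕B₂ `…GlueClassesG2` (swap transport), A′₂; tower 3: the off-locus zero ★ p861708 (LH4-p11 (g9) (B-Z1)).  What is LEFT is exactly the list of pending β-BOARD rows, as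
binders in their final shapes: `hH` (R8, the hanging line: `v_i(2ρ,2ρ,2ρ) = VH ρ`), `hC₁`∕`hC₂` (R7-C, the window on the feet of towers 1∕2), `hF₃` (the foot line of tower 3),
`hR6₁`∕`hR6₂`∕`hR6₃` (the κ-locus values `κₖ ρ s i`), the three definitional letters `hVG0∕1∕2` (`VG k ρ s = if 2ρ+ℓ₀ = c_k ∧ n_{k'} ≠ c_k + s then κₖ ρ s i else 0`, the shape
of ★ p861705 `rest_sum_eq_hanging_add_lines`), and `harith` (LH4-p10 (g6) STEP 2: hanging value + three s-line totals `= R`).  Conclusion: the `hRest` sum at that datum and slot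
`= R`; at `R := restTarget …` this IS the trunk's `hRest` instance, so `hRest_ofRecord` is a one-line application once the eight heads are ★.
HONEST LABEL.  Count-neutral glue; the pending rows are hypotheses; `hRest`, (β) OPEN; `HC_CM` is proved only modulo the 7 printed citations (2 remaining named inputs: hLiu418 =
`stmt-HodgeConjecture-24832`, h413 = `stmt-HodgeConjecture-24833`) until rung 0 closes.

## References
* [Kottwitz1986BaseChangeUnits] R. E. Kottwitz, *Base change for unit elements of Hecke algebras*, Compositio Math. 60 (1986), §1 pp. 240–241 (lattice counts by strata).
* [Rogawski1990] J. D. Rogawski, *Automorphic Representations of Unitary Groups in Three Variables*, Ann. of Math. Stud. 123 (1990), §4.9 Prop. 4.9.1 (a)(b) p. 55.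
-/

set_option autoImplicit false

noncomputable section

namespace Summit.HodgeConjecture.HodgeConjecture.Cruxes.H413.F0P3cDyRamOddLabelledRestAssembly

open Literature.NumberTheory.Automorphic Literature.NumberTheory.Automorphic.HermitianLattice
open Literature.NumberTheory.Automorphic.UnitaryLatticeTree Literature.NumberTheory.Automorphic.UnitaryThreeFourFrame
open Summit.HodgeConjecture.HodgeConjecture.Cruxes.H413.F0P3cDyRamFourFramePieces
open Summit.HodgeConjecture.HodgeConjecture.Cruxes.H413.F0P3cDyRamFourFrameCensusDefs
open Summit.HodgeConjecture.HodgeConjecture.Cruxes.H413.F0P3cDyRamStageOneBDefs (mcOfRecord)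
open Summit.HodgeConjecture.HodgeConjecture.Cruxes.H413.F0P3cDyRamStageOneBDerivedDefs (n0DerivedOfRecord mcOfRecord_le_n0DerivedOfRecord)
open Summit.HodgeConjecture.HodgeConjecture.Cruxes.H413.F0P3cDyRamDiagonalTorusDefs
open Summit.HodgeConjecture.HodgeConjecture.Cruxes.H413.F0P3cDyRamDiagonalStrataDefs
open Summit.HodgeConjecture.HodgeConjecture.Cruxes.H413.F0P3cDyRamLabelledOddCountDefs
open Summit.HodgeConjecture.HodgeConjecture.Cruxes.H413.F0P3cDyRamOddLabelledBoxSumDefs (IsRestShape)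
open Summit.HodgeConjecture.HodgeConjecture.Cruxes.H413.F0P3cDyRamOddLabelledRestReindex (sum_box_restShape_eq_of_rows)
open Summit.HodgeConjecture.HodgeConjecture.Cruxes.H413.F0P3cDyRamLabelledOddRestDispatchG1 (restValue_G1_of_rows)
open Summit.HodgeConjecture.HodgeConjecture.Cruxes.H413.F0P3cDyRamLabelledOddRestDispatchG2 (restValue_G2_of_rows)
open Summit.HodgeConjecture.HodgeConjecture.Cruxes.H413.F0P3cDyRamLabelledOddRestDispatchG3 (restValue_G3_of_rows)
open Summit.HodgeConjecture.HodgeConjecture.Cruxes.H413.F0P3cDyRamLabelledOddGlueClasses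
open Summit.HodgeConjecture.HodgeConjecture.Cruxes.H413.F0P3cDyRamLabelledOddGlueClassesG2
open Summit.HodgeConjecture.HodgeConjecture.Cruxes.H413.F0P3cDyRamLabelledOddOffLocusShellG3 (finsum_stratum_G3_shell_eq_zero_offLocus)
open Summit.HodgeConjecture.HodgeConjecture.Cruxes.H413.F0P3cDyRamLabelledOddStageBTable (three_mul_sub_two_add_mod_le_n0DerivedOfRecord)
open Summit.HodgeConjecture.HodgeConjecture.Cruxes.H413.F0P3cDyRamDiagonalKappaCoreHangingClass (two_le_d_of_v_two_lt_one)
open scoped Valued WithZero Matrix MatrixGroups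

variable {K : Type} [Field K] [Valued K ℤᵐ⁰] {σ : K →+* K} {ϖ : K} {d t : ℕ} {α β : K} {n₁ n₂ n₃ : ℕ}

/-- **THE REST ASSEMBLY MODULO THE PENDING ROWS.**  At a derived-record datum (`|2| < 1`, ramified datum, element datum at `N₀ = n0DerivedOfRecord d`, `T = diag(α, β, 1)`)
and a slot `i`: given the hanging line `hH` (R8), the windows `hC₁`, `hC₂` (R7-C, towers 1∕2), the foot line `hF₃` of tower 3, the κ-locus values `hR6₁`, `hR6₂`, `hR6₃` (free
closed forms `κ₀ κ₁ κ₂`), the three letters `hVG0∕1∕2` naming the towers' rest columns, and the arithmetic `harith` (hanging + three towers `= R`, the ★ socket's shape), the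
`hRest` sum of the (T2) trunk at that datum and slot equals `R`.  Every other rest row is ★ and plugged here by name (R7-A∕B ★ p861363, R7-A₂∕B₂, the tower-3 off-locus zero
★ p861708, the cells A′ inside the ★ dispatchers). [cite: Kottwitz1986BaseChangeUnits, §1 pp. 240–241] [cite: Rogawski1990, §4.9 Prop. 4.9.1 (a)(b) p. 55] -/
theorem restSum_eq_of_rows [CompleteSpace K] [Fintype 𝓀[K]] (h2 : Valued.v (2 : K) < 1) (hD : IsRamifiedQuadraticDatum σ ϖ d t)
    (hE : IsElementDatum σ ϖ (n0DerivedOfRecord d) α β n₁ n₂ n₃)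
    (T : GL (Fin 3) K) (hT : (T : Matrix (Fin 3) (Fin 3) K) = Matrix.diagonal ![α, β, 1]) (i : Fin 3)
    (VH : ℕ → ℚ) (κ₀ κ₁ κ₂ : ℕ → ℕ → Fin 3 → ℚ) (VG : Fin 3 → ℕ → ℕ → ℚ) (R : ℚ)
    (hH : ∀ ρ : ℕ, 1 ≤ ρ → 2 * ρ ≤ n₁ + n₂ + n₃ →
      ∑ᶠ M ∈ {M : Submodule 𝒪[K] (Fin 3 → K) | M ∈ stratum σ ϖ T ![2 * ρ, 2 * ρ, 2 * ρ] ∧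
          (LatticeInLevel ϖ (d % 2) (Matrix.diagonal ![α - 1, β - 1, 0]) M ∧ ¬ LatticeInLevel ϖ (d % 2 + 1) (Matrix.diagonal ![α - 1, β - 1, 0]) M ∧
            LatticeInLevel ϖ (mcOfRecord d) (Matrix.diagonal ![(α - 1) * (α - 1), (β - 1) * (β - 1), 0]) M)},
        (labelledOddCount σ ϖ 0 i (valueClassLabel σ ϖ (α - 1) (β - 1) (mstarOfRecord d) d) M : ℚ) /
          ((((unitStabilizer M).map (unitNormMap σ 3)).relIndex (fixedUnitTorus σ 3) : ℕ) : ℚ) = VH ρ)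
    (hC₁ : ∀ (ρ s : ℕ), 1 ≤ ρ → 1 ≤ s → n₁ = n₂ + s → n₂ ≤ 2 * ρ + d % 2 → 2 * ρ + mcOfRecord d ≤ 2 * n₂ → ∀ i : Fin 3,
      ∑ᶠ M ∈ {M : Submodule 𝒪[K] (Fin 3 → K) | M ∈ stratum σ ϖ T ![2 * ρ, 2 * ρ + s, 2 * ρ + s] ∧
          (LatticeInLevel ϖ (d % 2) (Matrix.diagonal ![α - 1, β - 1, 0]) M ∧ ¬ LatticeInLevel ϖ (d % 2 + 1) (Matrix.diagonal ![α - 1, β - 1, 0]) M ∧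
            LatticeInLevel ϖ (mcOfRecord d) (Matrix.diagonal ![(α - 1) * (α - 1), (β - 1) * (β - 1), 0]) M)},
        (labelledOddCount σ ϖ 0 i (valueClassLabel σ ϖ (α - 1) (β - 1) (mstarOfRecord d) d) M : ℚ) /
          ((((unitStabilizer M).map (unitNormMap σ 3)).relIndex (fixedUnitTorus σ 3) : ℕ) : ℚ) = 0)
    (hR6₁ : ∀ (ρ s : ℕ), 1 ≤ ρ → 1 ≤ s → 2 ∣ s → 2 * ρ + d % 2 = n₂ → n₁ ≠ n₂ + s → ∀ i : Fin 3,
      ∑ᶠ M ∈ {M : Submodule 𝒪[K] (Fin 3 → K) | M ∈ stratum σ ϖ T ![2 * ρ, 2 * ρ + s, 2 * ρ + s] ∧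
          (LatticeInLevel ϖ (d % 2) (Matrix.diagonal ![α - 1, β - 1, 0]) M ∧ ¬ LatticeInLevel ϖ (d % 2 + 1) (Matrix.diagonal ![α - 1, β - 1, 0]) M ∧
            LatticeInLevel ϖ (mcOfRecord d) (Matrix.diagonal ![(α - 1) * (α - 1), (β - 1) * (β - 1), 0]) M)},
        (labelledOddCount σ ϖ 0 i (valueClassLabel σ ϖ (α - 1) (β - 1) (mstarOfRecord d) d) M : ℚ) /
          ((((unitStabilizer M).map (unitNormMap σ 3)).relIndex (fixedUnitTorus σ 3) : ℕ) : ℚ) = κ₀ ρ s i)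
    (hC₂ : ∀ (ρ s : ℕ), 1 ≤ ρ → 1 ≤ s → n₂ = n₁ + s → n₁ ≤ 2 * ρ + d % 2 → 2 * ρ + mcOfRecord d ≤ 2 * n₁ → ∀ i : Fin 3,
      ∑ᶠ M ∈ {M : Submodule 𝒪[K] (Fin 3 → K) | M ∈ stratum σ ϖ T ![2 * ρ + s, 2 * ρ, 2 * ρ + s] ∧
          (LatticeInLevel ϖ (d % 2) (Matrix.diagonal ![α - 1, β - 1, 0]) M ∧ ¬ LatticeInLevel ϖ (d % 2 + 1) (Matrix.diagonal ![α - 1, β - 1, 0]) M ∧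
            LatticeInLevel ϖ (mcOfRecord d) (Matrix.diagonal ![(α - 1) * (α - 1), (β - 1) * (β - 1), 0]) M)},
        (labelledOddCount σ ϖ 0 i (valueClassLabel σ ϖ (α - 1) (β - 1) (mstarOfRecord d) d) M : ℚ) /
          ((((unitStabilizer M).map (unitNormMap σ 3)).relIndex (fixedUnitTorus σ 3) : ℕ) : ℚ) = 0)
    (hR6₂ : ∀ (ρ s : ℕ), 1 ≤ ρ → 1 ≤ s → 2 ∣ s → 2 * ρ + d % 2 = n₁ → n₂ ≠ n₁ + s → ∀ i : Fin 3,
      ∑ᶠ M ∈ {M : Submodule 𝒪[K] (Fin 3 → K) | M ∈ stratum σ ϖ T ![2 * ρ + s, 2 * ρ, 2 * ρ + s] ∧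
          (LatticeInLevel ϖ (d % 2) (Matrix.diagonal ![α - 1, β - 1, 0]) M ∧ ¬ LatticeInLevel ϖ (d % 2 + 1) (Matrix.diagonal ![α - 1, β - 1, 0]) M ∧
            LatticeInLevel ϖ (mcOfRecord d) (Matrix.diagonal ![(α - 1) * (α - 1), (β - 1) * (β - 1), 0]) M)},
        (labelledOddCount σ ϖ 0 i (valueClassLabel σ ϖ (α - 1) (β - 1) (mstarOfRecord d) d) M : ℚ) /
          ((((unitStabilizer M).map (unitNormMap σ 3)).relIndex (fixedUnitTorus σ 3) : ℕ) : ℚ) = κ₁ ρ s i)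
    (hF₃ : ∀ (ρ s : ℕ), 1 ≤ ρ → 1 ≤ s → 2 ∣ s → n₃ = n₂ + s → ∀ i : Fin 3,
      ∑ᶠ M ∈ {M : Submodule 𝒪[K] (Fin 3 → K) | M ∈ stratum σ ϖ T ![2 * ρ + s, 2 * ρ + s, 2 * ρ] ∧
          (LatticeInLevel ϖ (d % 2) (Matrix.diagonal ![α - 1, β - 1, 0]) M ∧ ¬ LatticeInLevel ϖ (d % 2 + 1) (Matrix.diagonal ![α - 1, β - 1, 0]) M ∧
            LatticeInLevel ϖ (mcOfRecord d) (Matrix.diagonal ![(α - 1) * (α - 1), (β - 1) * (β - 1), 0]) M)},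
        (labelledOddCount σ ϖ 0 i (valueClassLabel σ ϖ (α - 1) (β - 1) (mstarOfRecord d) d) M : ℚ) /
          ((((unitStabilizer M).map (unitNormMap σ 3)).relIndex (fixedUnitTorus σ 3) : ℕ) : ℚ) = 0)
    (hR6₃ : ∀ (ρ s : ℕ), 1 ≤ ρ → 1 ≤ s → 2 ∣ s → 2 * ρ + d % 2 = n₂ → n₃ ≠ n₂ + s → ∀ i : Fin 3,
      ∑ᶠ M ∈ {M : Submodule 𝒪[K] (Fin 3 → K) | M ∈ stratum σ ϖ T ![2 * ρ + s, 2 * ρ + s, 2 * ρ] ∧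
          (LatticeInLevel ϖ (d % 2) (Matrix.diagonal ![α - 1, β - 1, 0]) M ∧ ¬ LatticeInLevel ϖ (d % 2 + 1) (Matrix.diagonal ![α - 1, β - 1, 0]) M ∧
            LatticeInLevel ϖ (mcOfRecord d) (Matrix.diagonal ![(α - 1) * (α - 1), (β - 1) * (β - 1), 0]) M)},
        (labelledOddCount σ ϖ 0 i (valueClassLabel σ ϖ (α - 1) (β - 1) (mstarOfRecord d) d) M : ℚ) /
          ((((unitStabilizer M).map (unitNormMap σ 3)).relIndex (fixedUnitTorus σ 3) : ℕ) : ℚ) = κ₂ ρ s i)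
    (hVG0 : ∀ ρ s : ℕ, VG 0 ρ s = if 2 * ρ + d % 2 = n₂ ∧ n₁ ≠ n₂ + s then κ₀ ρ s i else 0)
    (hVG1 : ∀ ρ s : ℕ, VG 1 ρ s = if 2 * ρ + d % 2 = n₁ ∧ n₂ ≠ n₁ + s then κ₁ ρ s i else 0)
    (hVG2 : ∀ ρ s : ℕ, VG 2 ρ s = if 2 * ρ + d % 2 = n₂ ∧ n₃ ≠ n₂ + s then κ₂ ρ s i else 0)
    (harith : ∑ ρ ∈ Finset.Icc 1 ((n₁ + n₂ + n₃) / 2), VH ρ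
      + ∑ ρ ∈ Finset.Icc 1 ((n₁ + n₂ + n₃) / 2), ∑ s ∈ Finset.Icc 1 (n₁ + n₂ + n₃ - 2 * ρ),
          ((if 2 ∣ s ∧ ¬ (2 * ρ + s + d % 2 = n₁ ∧ 2 * ρ + 2 + d % 2 ≤ min n₂ n₃) then VG 0 ρ s else 0)
          + (if 2 ∣ s ∧ ¬ (2 * ρ + s + d % 2 = n₂ ∧ 2 * ρ + 2 + d % 2 ≤ min n₁ n₃) then VG 1 ρ s else 0)
          + (if 2 ∣ s ∧ ¬ (2 * ρ + s + d % 2 = n₃ ∧ 2 * ρ + 2 + d % 2 ≤ min n₁ n₂) then VG 2 ρ s else 0)) = R) :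
    (∑ a : Fin 3 → Fin (n₁ + n₂ + n₃ + 1),
      (if IsRestShape d n₁ n₂ n₃ (fun j => (a j : ℕ)) then
        ∑ᶠ M ∈ {M : Submodule 𝒪[K] (Fin 3 → K) | M ∈ stratum σ ϖ T (fun j => (a j : ℕ)) ∧
            (LatticeInLevel ϖ (d % 2) (Matrix.diagonal ![α - 1, β - 1, 0]) M ∧ ¬ LatticeInLevel ϖ (d % 2 + 1) (Matrix.diagonal ![α - 1, β - 1, 0]) M ∧
              LatticeInLevel ϖ (mcOfRecord d) (Matrix.diagonal ![(α - 1) * (α - 1), (β - 1) * (β - 1), 0]) M)},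
          (labelledOddCount σ ϖ 0 i (valueClassLabel σ ϖ (α - 1) (β - 1) (mstarOfRecord d) d) M : ℚ) /
            ((((unitStabilizer M).map (unitNormMap σ 3)).relIndex (fixedUnitTorus σ 3) : ℕ) : ℚ)
       else 0)) = R := by
  -- the derived record's letters
  have h2d : 2 ≤ d := two_le_d_of_v_two_lt_one hD h2
  have hmc : mcOfRecord d ≤ n0DerivedOfRecord d := mcOfRecord_le_n0DerivedOfRecord d
  have hreg := three_mul_sub_two_add_mod_le_n0DerivedOfRecord d
  have hdN₀ : d ≤ n0DerivedOfRecord d := le_trans (by omega) hreg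
  refine sum_box_restShape_eq_of_rows (n₁ + n₂ + n₃) d n₁ n₂ n₃
    (fun a : Fin 3 → ℕ =>
      ∑ᶠ M ∈ {M : Submodule 𝒪[K] (Fin 3 → K) | M ∈ stratum σ ϖ T a ∧
          (LatticeInLevel ϖ (d % 2) (Matrix.diagonal ![α - 1, β - 1, 0]) M ∧ ¬ LatticeInLevel ϖ (d % 2 + 1) (Matrix.diagonal ![α - 1, β - 1, 0]) M ∧
            LatticeInLevel ϖ (mcOfRecord d) (Matrix.diagonal ![(α - 1) * (α - 1), (β - 1) * (β - 1), 0]) M)},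
        (labelledOddCount σ ϖ 0 i (valueClassLabel σ ϖ (α - 1) (β - 1) (mstarOfRecord d) d) M : ℚ) /
          ((((unitStabilizer M).map (unitNormMap σ 3)).relIndex (fixedUnitTorus σ 3) : ℕ) : ℚ))
    VH VG R (fun ρ hρ hB => hH ρ hρ hB) ?_ ?_ ?_ harith
  · -- tower 1: ★ dispatcher, R7-A∕B ★ p861363 by name
    intro ρ s hρ hs _ h2s hnt
    rw [hVG0]
    exact restValue_G1_of_rows hD h2d hE hdN₀ hmc T hT κ₀
      (finsum_stratum_G1_shell_labelledOdd_div_relIndex_eq_zero_of_offFoot hD h2d hE hmc T hT)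
      (fun ρ s hρ hs hfoot hoff i => by
        rcases hoff with htube | htop
        · exact finsum_stratum_G1_shell_labelledOdd_div_relIndex_eq_zero_of_foot_tube hD hE T ρ s hρ hs hfoot htube i
        · exact finsum_stratum_G1_shell_labelledOdd_div_relIndex_eq_zero_of_foot_top hD hE T ρ s hρ hs hfoot htop i)
      hC₁ hR6₁ ρ s hρ hs h2s hnt i
  · -- tower 2: ★ dispatcher, R7-A₂∕B₂ (swap transport) by name
    intro ρ s hρ hs _ h2s hnt
    rw [hVG1]
    exact restValue_G2_of_rows hD h2d hE hdN₀ hmc T hT κ₁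
      (finsum_stratum_G2_shell_labelledOdd_div_relIndex_eq_zero_of_offFoot hD h2d hE hmc T hT)
      (finsum_stratum_G2_shell_labelledOdd_div_relIndex_eq_zero_of_foot_tube_or_top hD hE T hT) hC₂ hR6₂ ρ s hρ hs h2s hnt i
  · -- tower 3: ★ dispatcher, off-locus zero ★ p861708 by name
    intro ρ s hρ hs _ h2s hnt
    rw [hVG2]
    exact restValue_G3_of_rows hD hE hdN₀ T κ₂
      (fun ρ s hρ hs hloc hnr hnκ i => finsum_stratum_G3_shell_eq_zero_offLocus hD hE hmc T ρ s hρ hs hloc hnr hnκ _ _ i)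
      hF₃ hR6₃ ρ s hρ hs h2s hnt i

end Summit.HodgeConjecture.HodgeConjecture.Cruxes.H413.F0P3cDyRamOddLabelledRestAssembly

end
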